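/-
Copyright: the b2b-balaban T⁴-continuum CRUX team, row NE7b OWNER lineage `t4-ne7b-p1` (gen 145). Project licence.
-/
import Summits.QuantumFields.BalabanUV.T4Continuum.Spine.NE7b.SupInterpolatedFourthKernelEntry
import Summits.QuantumFields.BalabanUV.T4Continuum.Spine.NE7b.SupWeightedFourthOrderLettersThree

/-!
# THE ORDER-4 OUTPUT LETTERS OF THE WEIGHTED CLASS MAP (SCOPING-d17 (R-c)∕(d14)(3) at order 4; file (669) of (667)–(670)).  (655) bounds every fourth
# `ψ`-derivative entry of the one-step effective action `W⁺(ψ) = −log∫e^{−U(·+ψ)}dμ_{AAᵀ}` (the fourth-cumulant combination of tilted moments)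
# by the interpolated majorant `M₄′(x,y,z,t)`; (662)–(665) sum `M₄′` against the full-graph weight `Π_{pairs}ϑ` with one slot fixed.  THIS FILE
# composes them: for each of the four roles, `Σ_{free} |∂⁴W⁺(x,y,z,t)|·Πϑ ≤` the slot bound of (662)–(665) — the weighted OUTPUT slot letters of
# the next class member's `K4⁺ := |∂⁴W⁺|`, from the road's (655) hypotheses (stability, derivative letters κ_m, kernel majorants Hk∕K3∕K4,
# two-point letters, Brascamp–Lieb, decay compatibilities) and the weighted-class letters of SCOPING-d17 §D ONLY — no support letter, no
# finite-range hypothesis: with (659)∕(666) (profile letters = intrinsic × factor letters) THE WEIGHTED CLASS MAP CLOSES AT ORDER 4 up to the rate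
# bookkeeping (R-d) (row NE7b, node U5c; (655), (662)–(665) BY NAME; [folklore]).

Cell `pub-balaban`, sub-cell `t4`, spine estimate NE7b (`T4WeightBudget.RelWeightBound`; the cell's OWN estimate — NOT PRINTED in
[Bałaban 1983–89], NOT PROVED).  Crux-route work under `Spine/NE7b/` by the row OWNER (`t4-ne7b-p1` gen 145, file (669) of (667)–(670)) under FREEZE
(0)'s crux-prover clause; NOTHING of Bałaban's is named as a Lean object, valued or asserted; no `T4Continuum/Support` leaf typed; no
`def`, no notation (statements WRITTEN OUT as printed by (655)); zero `sorry`.  Imports (BY NAME): (655), (664).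

WHAT IS PROVED ([folklore]): **`fourth_derivative_weighted_slot_z`** (the other three slots: the sibling files); toy.

HONEST (what this is NOT).  The order-4 member of the class map only (order 5 and the rates are later files); finite-torus Gaussian
measure `μ_{AAᵀ}` with the road's regularisation; scalar skeleton ((A3), NC-NE7b-α UNRULED); nothing of Bałaban's asserted.  BY-NAME EFFECT ON
THE WALL: NONE.  NE7b NOT PRINTED ∕ NOT PROVED; spine PROVED 0∕9; rung (B)+1 — the programme's measures remain FINITE-torus statements; NOT
the mass gap, NOT Clay.  HONEST DEPENDENCY: continuum YM on T⁴ ⇐ BetaPertH ∧ nine spine estimates (0∕9 proved); BetaPertH ⇐ (D1) ∧ (D4)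
∧ CAP+tail; G-an2-4 gates asym, D1 and NE2∕3∕4.
-/

set_option autoImplicit false
set_option maxSynthPendingDepth 3

noncomputable section

namespace Summit.QuantumFields.BalabanUV.T4Continuum.NE7b.SupWeightedFourthOrderOutputThree

open MeasureTheory ProbabilityTheory Finset Real Matrix
open scoped BigOperators Matrix
open SupInterpolatedFourthKernelEntry (interpolated_fourth_kernel_entry)
open SupWeightedFourthOrderLettersThree (output_k4ϑ_z)

variable {ι κ : Type} [Fintype ι] [DecidableEq ι] [Fintype κ] [DecidableEq κ]

variable {U : EuclideanSpace ℝ ι → ℝ} {U' : EuclideanSpace ℝ ι → EuclideanSpace ℝ ι →L[ℝ] ℝ}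
  {U'' : EuclideanSpace ℝ ι → EuclideanSpace ℝ ι →L[ℝ] EuclideanSpace ℝ ι →L[ℝ] ℝ}
  {U₃ : EuclideanSpace ℝ ι → EuclideanSpace ℝ ι →L[ℝ] EuclideanSpace ℝ ι →L[ℝ] EuclideanSpace ℝ ι →L[ℝ] ℝ}
  {U₄ : EuclideanSpace ℝ ι → EuclideanSpace ℝ ι →L[ℝ] EuclideanSpace ℝ ι →L[ℝ] EuclideanSpace ℝ ι →L[ℝ] EuclideanSpace ℝ ι →L[ℝ] ℝ}
  {Hk : ι → ι → ℝ} {K3 : ι → ι → ι → ℝ} {K4 : ι → ι → ι → ι → ℝ} {A : Matrix ι κ ℝ} {D : κ → κ → ℝ}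
  {γop κ₀ κ₁ κ₂ κ₃ κ₄ a τ δ θp lam lamA αr αc hr γ dθ dθ' αθ βθ : ℝ} {θ : κ → κ → ℝ} {σ : ι → κ → ℝ} {ρ r : ι → ι → ℝ}
  {ϑ ϑ₂ : ι → ι → ℝ} {αθc αg1m αg2m αg1c αk4m1 αk4m2 αk4m3 αk4c hrϑ hcϑ G Θ6 S4 k4ϑ1 k4ϑ2 k4ϑ3 k4ϑ4 : ℝ}

set_option maxHeartbeats 800000 in
/-- **ORDER-4 OUTPUT LETTER OF THE WEIGHTED CLASS MAP, SLOT `z`**: the fourth `ψ`-derivative entries of the one-step effective action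
(the fourth cumulant combination bounded by `M₄′` in (655)) summed over the three free indices against the full-graph weight `Πϑ` obey the
weighted slot letter of (664) — from the road's (655) hypotheses and the weighted-class letters only (`hC4`: the tree constant's sign, cf. (657)'s
        `hCT`). [folklore] -/
theorem fourth_derivative_weighted_slot_z [Nonempty κ] (hΓop : (γop • (1 : Matrix ι ι ℝ) - A * Aᵀ).PosSemidef) (Y : Finset ι) (hUd : ∀ φ :
        EuclideanSpace ℝ ι, HasFDerivAt U (U' φ) φ) (hU'd : ∀ φ : EuclideanSpace ℝ ι, HasFDerivAt U' (U'' φ) φ) (hU''d : ∀ φ : EuclideanSpace ℝ ι,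
        HasFDerivAt U'' (U₃ φ) φ) (hU₃d : ∀ φ : EuclideanSpace ℝ ι, HasFDerivAt U₃ (U₄ φ) φ) (hU₄c : Continuous U₄) (hκ₀ : 0 ≤ κ₀) (hκ₁ : 0 ≤ κ₁)
        (ha : 0 ≤ a) (hτ : 0 < τ) (hδ : 0 < δ) (hθ0 : 0 < θp) (hθ1 : θp < 1) (hκθ : (2 * κ₀ * (1 + τ) + 4 * δ) * γop ≤ θp) (hκθw : 2 * κ₀ * (1 + τ)
        * γop + 4 * δ ≤ θp) (hstab : ∀ φ : EuclideanSpace ℝ ι, -(κ₀ * ∑ x ∈ Y, φ x ^ 2) ≤ U φ) (hU'b : ∀ φ : EuclideanSpace ℝ ι, ‖U' φ‖ ≤ κ₁ * (a +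
        ∑ x ∈ Y, φ x ^ 2)) (hU''b : ∀ φ : EuclideanSpace ℝ ι, ‖U'' φ‖ ≤ κ₂) (hU₃b : ∀ φ : EuclideanSpace ℝ ι, ‖U₃ φ‖ ≤ κ₃) (hU₄b : ∀ φ :
        EuclideanSpace ℝ ι, ‖U₄ φ‖ ≤ κ₄) (hlam : 0 ≤ lam) (hUsec : ∀ s : ℝ, 0 ≤ s → s ≤ 1 → ∀ a b : EuclideanSpace ℝ ι, U ((1 - s) • a + s • b) -
        lam / 2 * (s * (1 - s)) * ∑ i, (a i - b i) ^ 2 ≤ (1 - s) * U a + s * U b) (hρg : lam * γop < 1) (hHk : ∀ (φ : EuclideanSpace ℝ ι) (x z :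
        ι), |U'' φ (EuclideanSpace.single z (1 : ℝ)) (EuclideanSpace.single x (1 : ℝ))| ≤ Hk x z) (hHk0 : ∀ v u, 0 ≤ Hk v u) (hK3 : ∀ (φ :
        EuclideanSpace ℝ ι) (u x y : ι), |U₃ φ (EuclideanSpace.single u (1 : ℝ)) (EuclideanSpace.single x (1 : ℝ)) (EuclideanSpace.single y (1 :
        ℝ))| ≤ K3 x y u) (hK30 : ∀ x y u, 0 ≤ K3 x y u) (hK4 : ∀ (φ : EuclideanSpace ℝ ι) (u x y z : ι), |U₄ φ (EuclideanSpace.single u (1 : ℝ))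
        (EuclideanSpace.single x (1 : ℝ)) (EuclideanSpace.single y (1 : ℝ)) (EuclideanSpace.single z (1 : ℝ))| ≤ K4 x y z u) (hhr : ∀ v, ∑ u, Hk v
        u ≤ hr) (ψ : EuclideanSpace ℝ ι) (hαr : ∀ u, ∑ w, |A u w| ≤ αr) (hαc : ∀ w, ∑ u, |A u w| ≤ αc) (hlamA : ∀ x : κ, ∑ u, ∑ v, |A u x| * |A v
        x| * Hk v u ≤ lamA) (hlamA1 : lamA < 1) (hγ : αc * hr * αr / (1 - lamA) ≤ γ) (hγ1 : γ < 1) (hD : ∀ x y, 0 ≤ D x y) (hDC : ∀ x y, (if x = y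
        then (1 : ℝ) else 0) + ∑ z, D x z * ((if y = z then 0 else ∑ u, ∑ v, |A u y| * |A v z| * Hk v u) / (1 - lamA)) ≤ D x y) (hθnn : ∀ z w, 0 ≤
        θ z w) (hDθr : ∀ z, ∑ w, D z w * θ z w ≤ dθ) (hdθ : 0 ≤ dθ) (hDθc : ∀ w, ∑ z, D z w * θ z w ≤ dθ') (hdθ' : 0 ≤ dθ') (hσ0 : ∀ x w, 0 ≤ σ x
        w) (hσθ : ∀ x z w, σ x w ≤ σ x z * θ z w) (hρ1 : ∀ x y, 1 ≤ ρ x y) (hρsymm : ∀ x y, ρ x y = ρ y x) (hρmul : ∀ x y z, ρ x z ≤ ρ x y * ρ y z)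
        (hρσ : ∀ x y w, ρ x y ^ 8 ≤ σ x w * σ y w) (hr1 : ∀ x y, 1 ≤ r x y) (hrσ : ∀ x y w, r x y ^ 24 ≤ σ x w * σ y w) (haσ : ∀ v : ι, ∑ w, (∑ u,
        |A u w| * Hk v u) * σ v w ≤ αθ) (hβ : 0 ≤ βθ) (haσ' : ∀ (v : ι) (w : κ), (∑ u, |A u w| * Hk v u) * σ v w ≤ βθ) (hgσ : ∀ x y : ι, ∑ w, (∑ u,
        |A u w| * K3 x y u) * σ x w ≤ αθ) (hgσ' : ∀ (x y : ι) (w : κ), (∑ u, |A u w| * K3 x y u) * σ x w ≤ βθ)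
    (hϑ1 : ∀ x y, 1 ≤ ϑ x y) (hϑsymm : ∀ x y, ϑ x y = ϑ y x) (hϑmul : ∀ x y z, ϑ x z ≤ ϑ x y * ϑ y z) (hϑ₂symm : ∀ x y, ϑ₂ x y = ϑ₂ y x) (hϑ3 : ∀ x
        y, ϑ x y ^ 3 ≤ ϑ₂ x y) (hϑσ : ∀ x y w, ϑ x y ^ 4 ≤ σ x w * σ y w) (hG : ∀ a, ∑ b, ϑ a b ^ 4 / Real.sqrt (ρ a b) ≤ G) (hΘ : ∀ a, ∑ b, (ϑ a b
        ^ 3) ^ 2 / ϑ₂ a b ≤ Θ6) (hhrw : ∀ a, ∑ b, ϑ₂ a b * Hk a b ≤ hrϑ) (hhc : ∀ a, ∑ b, ϑ₂ a b * Hk b a ≤ hcϑ) (hrsymm : ∀ a b, r a b = r b a)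
        (hS4 : ∀ u, ∑ v, ϑ u v ^ 4 * (r u v ^ 2)⁻¹ ≤ S4) (hC4 : 0 ≤ (4 * (αθ * dθ * (βθ * dθ') / (1 - lamA)) + 3 * (αθ * dθ * (βθ * dθ') / (1 -
        lamA)) ^ 2 + 4 * (5 * (κ₂ ^ 4 * γop ^ 2) / (1 - lam * γop) ^ 2) + 4 * (50 * (κ₂ ^ 6 * γop ^ 3) / (1 - lam * γop) ^ 3) + 2 * (((5 * (κ₂ ^ 4
        * γop ^ 2) / (1 - lam * γop) ^ 2) + 1) / 2) * ((((5 * (κ₂ ^ 4 * γop ^ 2) / (1 - lam * γop) ^ 2) + 1) / 2) + (5 * (κ₂ ^ 4 * γop ^ 2) / (1 -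
        lam * γop) ^ 2)))) (hbσc : ∀ z', ∑ v, (∑ u, |A u z'| * Hk v u) * σ v z' ≤ αθc) (hαθc : 0 ≤ αθc) (hg1m : ∀ x, ∑ y, ϑ₂ x y * ∑ z', (∑ u, |A u
        z'| * K3 x y u) * σ x z' ≤ αg1m) (hg2m : ∀ y, ∑ x, ϑ₂ y x * ∑ z', (∑ u, |A u z'| * K3 x y u) * σ y z' ≤ αg2m) (hg1c : ∀ z', ∑ x, ∑ y, (∑ u,
        |A u z'| * K3 x y u) * (σ x z' * ϑ₂ x y) ≤ αg1c) (hαg1c : 0 ≤ αg1c) (hk4m2 : ∀ s, ∑ p, ∑ q, (ϑ₂ s p * ϑ₂ s q * ϑ₂ p q) * ∑ z', (∑ u, |A u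
        z'| * K4 p s q u) * σ s z' ≤ αk4m2) (hk4m3 : ∀ s, ∑ p, ∑ q, (ϑ₂ s p * ϑ₂ s q * ϑ₂ p q) * ∑ z', (∑ u, |A u z'| * K4 p q s u) * σ s z' ≤
        αk4m3) (hk4c : ∀ z', ∑ a, ∑ b, ∑ c, (∑ u, |A u z'| * K4 a b c u) * (σ a z' * (ϑ₂ a b * ϑ₂ a c * ϑ₂ b c)) ≤ αk4c) (hαk4c : 0 ≤ αk4c) (hk4 :
        ∀ z, ∑ x, ∑ y, ∑ t, K4 y z t x * (ϑ₂ x y * ϑ₂ x z * ϑ₂ x t * ϑ₂ y z * ϑ₂ y t * ϑ₂ z t) ≤ k4ϑ2) (z : ι) :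
    ∑ x, ∑ y, ∑ t, |(∫ ω : EuclideanSpace ℝ ι, exp (-U (ω + ψ)) ∂(multivariateGaussian 0 (A * Aᵀ)))⁻¹ * (∫ ω : EuclideanSpace ℝ ι, exp (-U (ω + ψ))
        * U₄ (ω + ψ) (EuclideanSpace.single x (1 : ℝ)) (EuclideanSpace.single y (1 : ℝ)) (EuclideanSpace.single z (1 : ℝ)) (EuclideanSpace.single t
        (1 : ℝ)) ∂(multivariateGaussian 0 (A * Aᵀ))) - (((∫ ω : EuclideanSpace ℝ ι, exp (-U (ω + ψ)) ∂(multivariateGaussian 0 (A * Aᵀ)))⁻¹ * (∫ ω :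
        EuclideanSpace ℝ ι, exp (-U (ω + ψ)) * (U₃ (ω + ψ) (EuclideanSpace.single x (1 : ℝ)) (EuclideanSpace.single z (1 : ℝ))
        (EuclideanSpace.single t (1 : ℝ)) * U' (ω + ψ) (EuclideanSpace.single y (1 : ℝ))) ∂(multivariateGaussian 0 (A * Aᵀ))) - ((∫ ω :
        EuclideanSpace ℝ ι, exp (-U (ω + ψ)) ∂(multivariateGaussian 0 (A * Aᵀ))) ^ 2)⁻¹ * ((∫ ω : EuclideanSpace ℝ ι, exp (-U (ω + ψ)) * U₃ (ω + ψ)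
        (EuclideanSpace.single x (1 : ℝ)) (EuclideanSpace.single z (1 : ℝ)) (EuclideanSpace.single t (1 : ℝ)) ∂(multivariateGaussian 0 (A * Aᵀ))) *
        (∫ ω : EuclideanSpace ℝ ι, exp (-U (ω + ψ)) * U' (ω + ψ) (EuclideanSpace.single y (1 : ℝ)) ∂(multivariateGaussian 0 (A * Aᵀ))))) + ((∫ ω :
        EuclideanSpace ℝ ι, exp (-U (ω + ψ)) ∂(multivariateGaussian 0 (A * Aᵀ)))⁻¹ * (∫ ω : EuclideanSpace ℝ ι, exp (-U (ω + ψ)) * (U₃ (ω + ψ)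
        (EuclideanSpace.single x (1 : ℝ)) (EuclideanSpace.single y (1 : ℝ)) (EuclideanSpace.single t (1 : ℝ)) * U' (ω + ψ) (EuclideanSpace.single z
        (1 : ℝ))) ∂(multivariateGaussian 0 (A * Aᵀ))) - ((∫ ω : EuclideanSpace ℝ ι, exp (-U (ω + ψ)) ∂(multivariateGaussian 0 (A * Aᵀ))) ^ 2)⁻¹ *
        ((∫ ω : EuclideanSpace ℝ ι, exp (-U (ω + ψ)) * U₃ (ω + ψ) (EuclideanSpace.single x (1 : ℝ)) (EuclideanSpace.single y (1 : ℝ))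
        (EuclideanSpace.single t (1 : ℝ)) ∂(multivariateGaussian 0 (A * Aᵀ))) * (∫ ω : EuclideanSpace ℝ ι, exp (-U (ω + ψ)) * U' (ω + ψ)
        (EuclideanSpace.single z (1 : ℝ)) ∂(multivariateGaussian 0 (A * Aᵀ))))) + ((∫ ω : EuclideanSpace ℝ ι, exp (-U (ω + ψ))
        ∂(multivariateGaussian 0 (A * Aᵀ)))⁻¹ * (∫ ω : EuclideanSpace ℝ ι, exp (-U (ω + ψ)) * (U₃ (ω + ψ) (EuclideanSpace.single x (1 : ℝ))
        (EuclideanSpace.single y (1 : ℝ)) (EuclideanSpace.single z (1 : ℝ)) * U' (ω + ψ) (EuclideanSpace.single t (1 : ℝ))) ∂(multivariateGaussian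
        0 (A * Aᵀ))) - ((∫ ω : EuclideanSpace ℝ ι, exp (-U (ω + ψ)) ∂(multivariateGaussian 0 (A * Aᵀ))) ^ 2)⁻¹ * ((∫ ω : EuclideanSpace ℝ ι, exp
        (-U (ω + ψ)) * U₃ (ω + ψ) (EuclideanSpace.single x (1 : ℝ)) (EuclideanSpace.single y (1 : ℝ)) (EuclideanSpace.single z (1 : ℝ))
        ∂(multivariateGaussian 0 (A * Aᵀ))) * (∫ ω : EuclideanSpace ℝ ι, exp (-U (ω + ψ)) * U' (ω + ψ) (EuclideanSpace.single t (1 : ℝ))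
        ∂(multivariateGaussian 0 (A * Aᵀ))))) + ((∫ ω : EuclideanSpace ℝ ι, exp (-U (ω + ψ)) ∂(multivariateGaussian 0 (A * Aᵀ)))⁻¹ * (∫ ω :
        EuclideanSpace ℝ ι, exp (-U (ω + ψ)) * (U' (ω + ψ) (EuclideanSpace.single x (1 : ℝ)) * U₃ (ω + ψ) (EuclideanSpace.single y (1 : ℝ))
        (EuclideanSpace.single z (1 : ℝ)) (EuclideanSpace.single t (1 : ℝ))) ∂(multivariateGaussian 0 (A * Aᵀ))) - ((∫ ω : EuclideanSpace ℝ ι, exp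
        (-U (ω + ψ)) ∂(multivariateGaussian 0 (A * Aᵀ))) ^ 2)⁻¹ * ((∫ ω : EuclideanSpace ℝ ι, exp (-U (ω + ψ)) * U' (ω + ψ) (EuclideanSpace.single
        x (1 : ℝ)) ∂(multivariateGaussian 0 (A * Aᵀ))) * (∫ ω : EuclideanSpace ℝ ι, exp (-U (ω + ψ)) * U₃ (ω + ψ) (EuclideanSpace.single y (1 : ℝ))
        (EuclideanSpace.single z (1 : ℝ)) (EuclideanSpace.single t (1 : ℝ)) ∂(multivariateGaussian 0 (A * Aᵀ)))))) - (((∫ ω : EuclideanSpace ℝ ι,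
        exp (-U (ω + ψ)) ∂(multivariateGaussian 0 (A * Aᵀ)))⁻¹ * (∫ ω : EuclideanSpace ℝ ι, exp (-U (ω + ψ)) * (U'' (ω + ψ) (EuclideanSpace.single
        x (1 : ℝ)) (EuclideanSpace.single y (1 : ℝ)) * U'' (ω + ψ) (EuclideanSpace.single z (1 : ℝ)) (EuclideanSpace.single t (1 : ℝ)))
        ∂(multivariateGaussian 0 (A * Aᵀ))) - ((∫ ω : EuclideanSpace ℝ ι, exp (-U (ω + ψ)) ∂(multivariateGaussian 0 (A * Aᵀ))) ^ 2)⁻¹ * ((∫ ω :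
        EuclideanSpace ℝ ι, exp (-U (ω + ψ)) * U'' (ω + ψ) (EuclideanSpace.single x (1 : ℝ)) (EuclideanSpace.single y (1 : ℝ))
        ∂(multivariateGaussian 0 (A * Aᵀ))) * (∫ ω : EuclideanSpace ℝ ι, exp (-U (ω + ψ)) * U'' (ω + ψ) (EuclideanSpace.single z (1 : ℝ))
        (EuclideanSpace.single t (1 : ℝ)) ∂(multivariateGaussian 0 (A * Aᵀ))))) + ((∫ ω : EuclideanSpace ℝ ι, exp (-U (ω + ψ))
        ∂(multivariateGaussian 0 (A * Aᵀ)))⁻¹ * (∫ ω : EuclideanSpace ℝ ι, exp (-U (ω + ψ)) * (U'' (ω + ψ) (EuclideanSpace.single x (1 : ℝ))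
        (EuclideanSpace.single z (1 : ℝ)) * U'' (ω + ψ) (EuclideanSpace.single y (1 : ℝ)) (EuclideanSpace.single t (1 : ℝ))) ∂(multivariateGaussian
        0 (A * Aᵀ))) - ((∫ ω : EuclideanSpace ℝ ι, exp (-U (ω + ψ)) ∂(multivariateGaussian 0 (A * Aᵀ))) ^ 2)⁻¹ * ((∫ ω : EuclideanSpace ℝ ι, exp
        (-U (ω + ψ)) * U'' (ω + ψ) (EuclideanSpace.single x (1 : ℝ)) (EuclideanSpace.single z (1 : ℝ)) ∂(multivariateGaussian 0 (A * Aᵀ))) * (∫ ω :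
        EuclideanSpace ℝ ι, exp (-U (ω + ψ)) * U'' (ω + ψ) (EuclideanSpace.single y (1 : ℝ)) (EuclideanSpace.single t (1 : ℝ))
        ∂(multivariateGaussian 0 (A * Aᵀ))))) + ((∫ ω : EuclideanSpace ℝ ι, exp (-U (ω + ψ)) ∂(multivariateGaussian 0 (A * Aᵀ)))⁻¹ * (∫ ω :
        EuclideanSpace ℝ ι, exp (-U (ω + ψ)) * (U'' (ω + ψ) (EuclideanSpace.single x (1 : ℝ)) (EuclideanSpace.single t (1 : ℝ)) * U'' (ω + ψ)
        (EuclideanSpace.single y (1 : ℝ)) (EuclideanSpace.single z (1 : ℝ))) ∂(multivariateGaussian 0 (A * Aᵀ))) - ((∫ ω : EuclideanSpace ℝ ι, exp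
        (-U (ω + ψ)) ∂(multivariateGaussian 0 (A * Aᵀ))) ^ 2)⁻¹ * ((∫ ω : EuclideanSpace ℝ ι, exp (-U (ω + ψ)) * U'' (ω + ψ) (EuclideanSpace.single
        x (1 : ℝ)) (EuclideanSpace.single t (1 : ℝ)) ∂(multivariateGaussian 0 (A * Aᵀ))) * (∫ ω : EuclideanSpace ℝ ι, exp (-U (ω + ψ)) * U'' (ω +
        ψ) (EuclideanSpace.single y (1 : ℝ)) (EuclideanSpace.single z (1 : ℝ)) ∂(multivariateGaussian 0 (A * Aᵀ)))))) + ((∫ ω : EuclideanSpace ℝ ι,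
        exp (-U (ω + ψ)) ∂(multivariateGaussian 0 (A * Aᵀ)))⁻¹ * (∫ ω : EuclideanSpace ℝ ι, exp (-U (ω + ψ)) * ((U'' (ω + ψ) (EuclideanSpace.single
        x (1 : ℝ)) (EuclideanSpace.single y (1 : ℝ)) - ((∫ ω : EuclideanSpace ℝ ι, exp (-U (ω + ψ)) ∂(multivariateGaussian 0 (A * Aᵀ)))⁻¹ * (∫ ω :
        EuclideanSpace ℝ ι, exp (-U (ω + ψ)) * U'' (ω + ψ) (EuclideanSpace.single x (1 : ℝ)) (EuclideanSpace.single y (1 : ℝ))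
        ∂(multivariateGaussian 0 (A * Aᵀ))))) * (U' (ω + ψ) (EuclideanSpace.single z (1 : ℝ)) - ((∫ ω : EuclideanSpace ℝ ι, exp (-U (ω + ψ))
        ∂(multivariateGaussian 0 (A * Aᵀ)))⁻¹ * (∫ ω : EuclideanSpace ℝ ι, exp (-U (ω + ψ)) * U' (ω + ψ) (EuclideanSpace.single z (1 : ℝ))
        ∂(multivariateGaussian 0 (A * Aᵀ))))) * (U' (ω + ψ) (EuclideanSpace.single t (1 : ℝ)) - ((∫ ω : EuclideanSpace ℝ ι, exp (-U (ω + ψ))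
        ∂(multivariateGaussian 0 (A * Aᵀ)))⁻¹ * (∫ ω : EuclideanSpace ℝ ι, exp (-U (ω + ψ)) * U' (ω + ψ) (EuclideanSpace.single t (1 : ℝ))
        ∂(multivariateGaussian 0 (A * Aᵀ)))))) ∂(multivariateGaussian 0 (A * Aᵀ))) + (∫ ω : EuclideanSpace ℝ ι, exp (-U (ω + ψ))
        ∂(multivariateGaussian 0 (A * Aᵀ)))⁻¹ * (∫ ω : EuclideanSpace ℝ ι, exp (-U (ω + ψ)) * ((U'' (ω + ψ) (EuclideanSpace.single x (1 : ℝ))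
        (EuclideanSpace.single z (1 : ℝ)) - ((∫ ω : EuclideanSpace ℝ ι, exp (-U (ω + ψ)) ∂(multivariateGaussian 0 (A * Aᵀ)))⁻¹ * (∫ ω :
        EuclideanSpace ℝ ι, exp (-U (ω + ψ)) * U'' (ω + ψ) (EuclideanSpace.single x (1 : ℝ)) (EuclideanSpace.single z (1 : ℝ))
        ∂(multivariateGaussian 0 (A * Aᵀ))))) * (U' (ω + ψ) (EuclideanSpace.single y (1 : ℝ)) - ((∫ ω : EuclideanSpace ℝ ι, exp (-U (ω + ψ))
        ∂(multivariateGaussian 0 (A * Aᵀ)))⁻¹ * (∫ ω : EuclideanSpace ℝ ι, exp (-U (ω + ψ)) * U' (ω + ψ) (EuclideanSpace.single y (1 : ℝ))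
        ∂(multivariateGaussian 0 (A * Aᵀ))))) * (U' (ω + ψ) (EuclideanSpace.single t (1 : ℝ)) - ((∫ ω : EuclideanSpace ℝ ι, exp (-U (ω + ψ))
        ∂(multivariateGaussian 0 (A * Aᵀ)))⁻¹ * (∫ ω : EuclideanSpace ℝ ι, exp (-U (ω + ψ)) * U' (ω + ψ) (EuclideanSpace.single t (1 : ℝ))
        ∂(multivariateGaussian 0 (A * Aᵀ)))))) ∂(multivariateGaussian 0 (A * Aᵀ))) + (∫ ω : EuclideanSpace ℝ ι, exp (-U (ω + ψ))
        ∂(multivariateGaussian 0 (A * Aᵀ)))⁻¹ * (∫ ω : EuclideanSpace ℝ ι, exp (-U (ω + ψ)) * ((U'' (ω + ψ) (EuclideanSpace.single x (1 : ℝ))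
        (EuclideanSpace.single t (1 : ℝ)) - ((∫ ω : EuclideanSpace ℝ ι, exp (-U (ω + ψ)) ∂(multivariateGaussian 0 (A * Aᵀ)))⁻¹ * (∫ ω :
        EuclideanSpace ℝ ι, exp (-U (ω + ψ)) * U'' (ω + ψ) (EuclideanSpace.single x (1 : ℝ)) (EuclideanSpace.single t (1 : ℝ))
        ∂(multivariateGaussian 0 (A * Aᵀ))))) * (U' (ω + ψ) (EuclideanSpace.single y (1 : ℝ)) - ((∫ ω : EuclideanSpace ℝ ι, exp (-U (ω + ψ))
        ∂(multivariateGaussian 0 (A * Aᵀ)))⁻¹ * (∫ ω : EuclideanSpace ℝ ι, exp (-U (ω + ψ)) * U' (ω + ψ) (EuclideanSpace.single y (1 : ℝ))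
        ∂(multivariateGaussian 0 (A * Aᵀ))))) * (U' (ω + ψ) (EuclideanSpace.single z (1 : ℝ)) - ((∫ ω : EuclideanSpace ℝ ι, exp (-U (ω + ψ))
        ∂(multivariateGaussian 0 (A * Aᵀ)))⁻¹ * (∫ ω : EuclideanSpace ℝ ι, exp (-U (ω + ψ)) * U' (ω + ψ) (EuclideanSpace.single z (1 : ℝ))
        ∂(multivariateGaussian 0 (A * Aᵀ)))))) ∂(multivariateGaussian 0 (A * Aᵀ))) + (∫ ω : EuclideanSpace ℝ ι, exp (-U (ω + ψ))
        ∂(multivariateGaussian 0 (A * Aᵀ)))⁻¹ * (∫ ω : EuclideanSpace ℝ ι, exp (-U (ω + ψ)) * ((U' (ω + ψ) (EuclideanSpace.single x (1 : ℝ)) - ((∫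
        ω : EuclideanSpace ℝ ι, exp (-U (ω + ψ)) ∂(multivariateGaussian 0 (A * Aᵀ)))⁻¹ * (∫ ω : EuclideanSpace ℝ ι, exp (-U (ω + ψ)) * U' (ω + ψ)
        (EuclideanSpace.single x (1 : ℝ)) ∂(multivariateGaussian 0 (A * Aᵀ))))) * (U'' (ω + ψ) (EuclideanSpace.single y (1 : ℝ))
        (EuclideanSpace.single z (1 : ℝ)) - ((∫ ω : EuclideanSpace ℝ ι, exp (-U (ω + ψ)) ∂(multivariateGaussian 0 (A * Aᵀ)))⁻¹ * (∫ ω :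
        EuclideanSpace ℝ ι, exp (-U (ω + ψ)) * U'' (ω + ψ) (EuclideanSpace.single y (1 : ℝ)) (EuclideanSpace.single z (1 : ℝ))
        ∂(multivariateGaussian 0 (A * Aᵀ))))) * (U' (ω + ψ) (EuclideanSpace.single t (1 : ℝ)) - ((∫ ω : EuclideanSpace ℝ ι, exp (-U (ω + ψ))
        ∂(multivariateGaussian 0 (A * Aᵀ)))⁻¹ * (∫ ω : EuclideanSpace ℝ ι, exp (-U (ω + ψ)) * U' (ω + ψ) (EuclideanSpace.single t (1 : ℝ))
        ∂(multivariateGaussian 0 (A * Aᵀ)))))) ∂(multivariateGaussian 0 (A * Aᵀ))) + (∫ ω : EuclideanSpace ℝ ι, exp (-U (ω + ψ))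
        ∂(multivariateGaussian 0 (A * Aᵀ)))⁻¹ * (∫ ω : EuclideanSpace ℝ ι, exp (-U (ω + ψ)) * ((U' (ω + ψ) (EuclideanSpace.single x (1 : ℝ)) - ((∫
        ω : EuclideanSpace ℝ ι, exp (-U (ω + ψ)) ∂(multivariateGaussian 0 (A * Aᵀ)))⁻¹ * (∫ ω : EuclideanSpace ℝ ι, exp (-U (ω + ψ)) * U' (ω + ψ)
        (EuclideanSpace.single x (1 : ℝ)) ∂(multivariateGaussian 0 (A * Aᵀ))))) * (U'' (ω + ψ) (EuclideanSpace.single y (1 : ℝ))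
        (EuclideanSpace.single t (1 : ℝ)) - ((∫ ω : EuclideanSpace ℝ ι, exp (-U (ω + ψ)) ∂(multivariateGaussian 0 (A * Aᵀ)))⁻¹ * (∫ ω :
        EuclideanSpace ℝ ι, exp (-U (ω + ψ)) * U'' (ω + ψ) (EuclideanSpace.single y (1 : ℝ)) (EuclideanSpace.single t (1 : ℝ))
        ∂(multivariateGaussian 0 (A * Aᵀ))))) * (U' (ω + ψ) (EuclideanSpace.single z (1 : ℝ)) - ((∫ ω : EuclideanSpace ℝ ι, exp (-U (ω + ψ))
        ∂(multivariateGaussian 0 (A * Aᵀ)))⁻¹ * (∫ ω : EuclideanSpace ℝ ι, exp (-U (ω + ψ)) * U' (ω + ψ) (EuclideanSpace.single z (1 : ℝ))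
        ∂(multivariateGaussian 0 (A * Aᵀ)))))) ∂(multivariateGaussian 0 (A * Aᵀ))) + (∫ ω : EuclideanSpace ℝ ι, exp (-U (ω + ψ))
        ∂(multivariateGaussian 0 (A * Aᵀ)))⁻¹ * (∫ ω : EuclideanSpace ℝ ι, exp (-U (ω + ψ)) * ((U' (ω + ψ) (EuclideanSpace.single x (1 : ℝ)) - ((∫
        ω : EuclideanSpace ℝ ι, exp (-U (ω + ψ)) ∂(multivariateGaussian 0 (A * Aᵀ)))⁻¹ * (∫ ω : EuclideanSpace ℝ ι, exp (-U (ω + ψ)) * U' (ω + ψ)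
        (EuclideanSpace.single x (1 : ℝ)) ∂(multivariateGaussian 0 (A * Aᵀ))))) * (U'' (ω + ψ) (EuclideanSpace.single z (1 : ℝ))
        (EuclideanSpace.single t (1 : ℝ)) - ((∫ ω : EuclideanSpace ℝ ι, exp (-U (ω + ψ)) ∂(multivariateGaussian 0 (A * Aᵀ)))⁻¹ * (∫ ω :
        EuclideanSpace ℝ ι, exp (-U (ω + ψ)) * U'' (ω + ψ) (EuclideanSpace.single z (1 : ℝ)) (EuclideanSpace.single t (1 : ℝ))
        ∂(multivariateGaussian 0 (A * Aᵀ))))) * (U' (ω + ψ) (EuclideanSpace.single y (1 : ℝ)) - ((∫ ω : EuclideanSpace ℝ ι, exp (-U (ω + ψ))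
        ∂(multivariateGaussian 0 (A * Aᵀ)))⁻¹ * (∫ ω : EuclideanSpace ℝ ι, exp (-U (ω + ψ)) * U' (ω + ψ) (EuclideanSpace.single y (1 : ℝ))
        ∂(multivariateGaussian 0 (A * Aᵀ)))))) ∂(multivariateGaussian 0 (A * Aᵀ)))) - ((∫ ω : EuclideanSpace ℝ ι, exp (-U (ω + ψ))
        ∂(multivariateGaussian 0 (A * Aᵀ)))⁻¹ * (∫ ω : EuclideanSpace ℝ ι, exp (-U (ω + ψ)) * ((U' (ω + ψ) (EuclideanSpace.single x (1 : ℝ)) - ((∫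
        ω : EuclideanSpace ℝ ι, exp (-U (ω + ψ)) ∂(multivariateGaussian 0 (A * Aᵀ)))⁻¹ * (∫ ω : EuclideanSpace ℝ ι, exp (-U (ω + ψ)) * U' (ω + ψ)
        (EuclideanSpace.single x (1 : ℝ)) ∂(multivariateGaussian 0 (A * Aᵀ))))) * (U' (ω + ψ) (EuclideanSpace.single y (1 : ℝ)) - ((∫ ω :
        EuclideanSpace ℝ ι, exp (-U (ω + ψ)) ∂(multivariateGaussian 0 (A * Aᵀ)))⁻¹ * (∫ ω : EuclideanSpace ℝ ι, exp (-U (ω + ψ)) * U' (ω + ψ)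
        (EuclideanSpace.single y (1 : ℝ)) ∂(multivariateGaussian 0 (A * Aᵀ))))) * (U' (ω + ψ) (EuclideanSpace.single z (1 : ℝ)) - ((∫ ω :
        EuclideanSpace ℝ ι, exp (-U (ω + ψ)) ∂(multivariateGaussian 0 (A * Aᵀ)))⁻¹ * (∫ ω : EuclideanSpace ℝ ι, exp (-U (ω + ψ)) * U' (ω + ψ)
        (EuclideanSpace.single z (1 : ℝ)) ∂(multivariateGaussian 0 (A * Aᵀ))))) * (U' (ω + ψ) (EuclideanSpace.single t (1 : ℝ)) - ((∫ ω :
        EuclideanSpace ℝ ι, exp (-U (ω + ψ)) ∂(multivariateGaussian 0 (A * Aᵀ)))⁻¹ * (∫ ω : EuclideanSpace ℝ ι, exp (-U (ω + ψ)) * U' (ω + ψ)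
        (EuclideanSpace.single t (1 : ℝ)) ∂(multivariateGaussian 0 (A * Aᵀ)))))) ∂(multivariateGaussian 0 (A * Aᵀ))) - ((∫ ω : EuclideanSpace ℝ ι,
        exp (-U (ω + ψ)) ∂(multivariateGaussian 0 (A * Aᵀ)))⁻¹ * (∫ ω : EuclideanSpace ℝ ι, exp (-U (ω + ψ)) * ((U' (ω + ψ) (EuclideanSpace.single
        x (1 : ℝ)) - ((∫ ω : EuclideanSpace ℝ ι, exp (-U (ω + ψ)) ∂(multivariateGaussian 0 (A * Aᵀ)))⁻¹ * (∫ ω : EuclideanSpace ℝ ι, exp (-U (ω +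
        ψ)) * U' (ω + ψ) (EuclideanSpace.single x (1 : ℝ)) ∂(multivariateGaussian 0 (A * Aᵀ))))) * (U' (ω + ψ) (EuclideanSpace.single y (1 : ℝ)) -
        ((∫ ω : EuclideanSpace ℝ ι, exp (-U (ω + ψ)) ∂(multivariateGaussian 0 (A * Aᵀ)))⁻¹ * (∫ ω : EuclideanSpace ℝ ι, exp (-U (ω + ψ)) * U' (ω +
        ψ) (EuclideanSpace.single y (1 : ℝ)) ∂(multivariateGaussian 0 (A * Aᵀ)))))) ∂(multivariateGaussian 0 (A * Aᵀ)))) * ((∫ ω : EuclideanSpace ℝ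
        ι, exp (-U (ω + ψ)) ∂(multivariateGaussian 0 (A * Aᵀ)))⁻¹ * (∫ ω : EuclideanSpace ℝ ι, exp (-U (ω + ψ)) * ((U' (ω + ψ)
        (EuclideanSpace.single z (1 : ℝ)) - ((∫ ω : EuclideanSpace ℝ ι, exp (-U (ω + ψ)) ∂(multivariateGaussian 0 (A * Aᵀ)))⁻¹ * (∫ ω :
        EuclideanSpace ℝ ι, exp (-U (ω + ψ)) * U' (ω + ψ) (EuclideanSpace.single z (1 : ℝ)) ∂(multivariateGaussian 0 (A * Aᵀ))))) * (U' (ω + ψ)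
        (EuclideanSpace.single t (1 : ℝ)) - ((∫ ω : EuclideanSpace ℝ ι, exp (-U (ω + ψ)) ∂(multivariateGaussian 0 (A * Aᵀ)))⁻¹ * (∫ ω :
        EuclideanSpace ℝ ι, exp (-U (ω + ψ)) * U' (ω + ψ) (EuclideanSpace.single t (1 : ℝ)) ∂(multivariateGaussian 0 (A * Aᵀ))))))
        ∂(multivariateGaussian 0 (A * Aᵀ)))) - ((∫ ω : EuclideanSpace ℝ ι, exp (-U (ω + ψ)) ∂(multivariateGaussian 0 (A * Aᵀ)))⁻¹ * (∫ ω :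
        EuclideanSpace ℝ ι, exp (-U (ω + ψ)) * ((U' (ω + ψ) (EuclideanSpace.single x (1 : ℝ)) - ((∫ ω : EuclideanSpace ℝ ι, exp (-U (ω + ψ))
        ∂(multivariateGaussian 0 (A * Aᵀ)))⁻¹ * (∫ ω : EuclideanSpace ℝ ι, exp (-U (ω + ψ)) * U' (ω + ψ) (EuclideanSpace.single x (1 : ℝ))
        ∂(multivariateGaussian 0 (A * Aᵀ))))) * (U' (ω + ψ) (EuclideanSpace.single z (1 : ℝ)) - ((∫ ω : EuclideanSpace ℝ ι, exp (-U (ω + ψ))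
        ∂(multivariateGaussian 0 (A * Aᵀ)))⁻¹ * (∫ ω : EuclideanSpace ℝ ι, exp (-U (ω + ψ)) * U' (ω + ψ) (EuclideanSpace.single z (1 : ℝ))
        ∂(multivariateGaussian 0 (A * Aᵀ)))))) ∂(multivariateGaussian 0 (A * Aᵀ)))) * ((∫ ω : EuclideanSpace ℝ ι, exp (-U (ω + ψ))
        ∂(multivariateGaussian 0 (A * Aᵀ)))⁻¹ * (∫ ω : EuclideanSpace ℝ ι, exp (-U (ω + ψ)) * ((U' (ω + ψ) (EuclideanSpace.single y (1 : ℝ)) - ((∫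
        ω : EuclideanSpace ℝ ι, exp (-U (ω + ψ)) ∂(multivariateGaussian 0 (A * Aᵀ)))⁻¹ * (∫ ω : EuclideanSpace ℝ ι, exp (-U (ω + ψ)) * U' (ω + ψ)
        (EuclideanSpace.single y (1 : ℝ)) ∂(multivariateGaussian 0 (A * Aᵀ))))) * (U' (ω + ψ) (EuclideanSpace.single t (1 : ℝ)) - ((∫ ω :
        EuclideanSpace ℝ ι, exp (-U (ω + ψ)) ∂(multivariateGaussian 0 (A * Aᵀ)))⁻¹ * (∫ ω : EuclideanSpace ℝ ι, exp (-U (ω + ψ)) * U' (ω + ψ)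
        (EuclideanSpace.single t (1 : ℝ)) ∂(multivariateGaussian 0 (A * Aᵀ)))))) ∂(multivariateGaussian 0 (A * Aᵀ)))) - ((∫ ω : EuclideanSpace ℝ ι,
        exp (-U (ω + ψ)) ∂(multivariateGaussian 0 (A * Aᵀ)))⁻¹ * (∫ ω : EuclideanSpace ℝ ι, exp (-U (ω + ψ)) * ((U' (ω + ψ) (EuclideanSpace.single
        x (1 : ℝ)) - ((∫ ω : EuclideanSpace ℝ ι, exp (-U (ω + ψ)) ∂(multivariateGaussian 0 (A * Aᵀ)))⁻¹ * (∫ ω : EuclideanSpace ℝ ι, exp (-U (ω +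
        ψ)) * U' (ω + ψ) (EuclideanSpace.single x (1 : ℝ)) ∂(multivariateGaussian 0 (A * Aᵀ))))) * (U' (ω + ψ) (EuclideanSpace.single t (1 : ℝ)) -
        ((∫ ω : EuclideanSpace ℝ ι, exp (-U (ω + ψ)) ∂(multivariateGaussian 0 (A * Aᵀ)))⁻¹ * (∫ ω : EuclideanSpace ℝ ι, exp (-U (ω + ψ)) * U' (ω +
        ψ) (EuclideanSpace.single t (1 : ℝ)) ∂(multivariateGaussian 0 (A * Aᵀ)))))) ∂(multivariateGaussian 0 (A * Aᵀ)))) * ((∫ ω : EuclideanSpace ℝ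
        ι, exp (-U (ω + ψ)) ∂(multivariateGaussian 0 (A * Aᵀ)))⁻¹ * (∫ ω : EuclideanSpace ℝ ι, exp (-U (ω + ψ)) * ((U' (ω + ψ)
        (EuclideanSpace.single y (1 : ℝ)) - ((∫ ω : EuclideanSpace ℝ ι, exp (-U (ω + ψ)) ∂(multivariateGaussian 0 (A * Aᵀ)))⁻¹ * (∫ ω :
        EuclideanSpace ℝ ι, exp (-U (ω + ψ)) * U' (ω + ψ) (EuclideanSpace.single y (1 : ℝ)) ∂(multivariateGaussian 0 (A * Aᵀ))))) * (U' (ω + ψ)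
        (EuclideanSpace.single z (1 : ℝ)) - ((∫ ω : EuclideanSpace ℝ ι, exp (-U (ω + ψ)) ∂(multivariateGaussian 0 (A * Aᵀ)))⁻¹ * (∫ ω :
        EuclideanSpace ℝ ι, exp (-U (ω + ψ)) * U' (ω + ψ) (EuclideanSpace.single z (1 : ℝ)) ∂(multivariateGaussian 0 (A * Aᵀ))))))
        ∂(multivariateGaussian 0 (A * Aᵀ)))))| * (ϑ x y * ϑ x z * ϑ x t * ϑ y z * ϑ y t * ϑ z t) ≤
      k4ϑ2 + dθ * αk4m2 * (dθ' * αθc) / (1 - lamA) + dθ * αθ * (dθ' * αk4c) / (1 - lamA) + dθ * αk4m3 * (dθ' * αθc) / (1 - lamA) + dθ * αk4m2 *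
        (dθ' * αθc) / (1 - lamA) + dθ * αg1m * (dθ' * αg1c) / (1 - lamA) + dθ * αg2m * (dθ' * αg1c) / (1 - lamA) + dθ * αg2m * (dθ' * αg1c) / (1 -
        lamA) + Real.sqrt (2 * Real.sqrt (5 * (κ₂ ^ 4 * γop ^ 2) / (1 - lam * γop) ^ 2) * (4 * Real.sqrt ((5 * ((κ₂ ^ 4 + κ₃ ^ 4) * γop ^ 2) / (1 -
        lam * γop) ^ 2) * (αθ * dθ * (βθ * dθ') / (1 - lamA))))) * (G * (Real.sqrt (hcϑ * Θ6) * G)) + Real.sqrt (2 * Real.sqrt (5 * (κ₂ ^ 4 * γop ^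
        2) / (1 - lam * γop) ^ 2) * (4 * Real.sqrt ((5 * ((κ₂ ^ 4 + κ₃ ^ 4) * γop ^ 2) / (1 - lam * γop) ^ 2) * (αθ * dθ * (βθ * dθ') / (1 -
        lamA))))) * (Real.sqrt (hrϑ * Θ6) * (G * G)) + Real.sqrt (2 * Real.sqrt (5 * (κ₂ ^ 4 * γop ^ 2) / (1 - lam * γop) ^ 2) * (4 * Real.sqrt ((5
        * ((κ₂ ^ 4 + κ₃ ^ 4) * γop ^ 2) / (1 - lam * γop) ^ 2) * (αθ * dθ * (βθ * dθ') / (1 - lamA))))) * (G * (G * Real.sqrt (hcϑ * Θ6))) +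
        Real.sqrt (2 * Real.sqrt (5 * (κ₂ ^ 4 * γop ^ 2) / (1 - lam * γop) ^ 2) * (4 * Real.sqrt ((5 * ((κ₂ ^ 4 + κ₃ ^ 4) * γop ^ 2) / (1 - lam *
        γop) ^ 2) * (αθ * dθ * (βθ * dθ') / (1 - lamA))))) * (Real.sqrt (hrϑ * Θ6) * (G * G)) + Real.sqrt (2 * Real.sqrt (5 * (κ₂ ^ 4 * γop ^ 2) /
        (1 - lam * γop) ^ 2) * (4 * Real.sqrt ((5 * ((κ₂ ^ 4 + κ₃ ^ 4) * γop ^ 2) / (1 - lam * γop) ^ 2) * (αθ * dθ * (βθ * dθ') / (1 - lamA))))) *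
        (G * (G * Real.sqrt (hcϑ * Θ6))) + Real.sqrt (2 * Real.sqrt (5 * (κ₂ ^ 4 * γop ^ 2) / (1 - lam * γop) ^ 2) * (4 * Real.sqrt ((5 * ((κ₂ ^ 4
        + κ₃ ^ 4) * γop ^ 2) / (1 - lam * γop) ^ 2) * (αθ * dθ * (βθ * dθ') / (1 - lamA))))) * (G * (G * Real.sqrt (hcϑ * Θ6))) + (4 * (αθ * dθ *
        (βθ * dθ') / (1 - lamA)) + 3 * (αθ * dθ * (βθ * dθ') / (1 - lamA)) ^ 2 + 4 * (5 * (κ₂ ^ 4 * γop ^ 2) / (1 - lam * γop) ^ 2) + 4 * (50 * (κ₂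
        ^ 6 * γop ^ 3) / (1 - lam * γop) ^ 3) + 2 * (((5 * (κ₂ ^ 4 * γop ^ 2) / (1 - lam * γop) ^ 2) + 1) / 2) * ((((5 * (κ₂ ^ 4 * γop ^ 2) / (1 -
        lam * γop) ^ 2) + 1) / 2) + (5 * (κ₂ ^ 4 * γop ^ 2) / (1 - lam * γop) ^ 2))) * (16 * S4 ^ 3) := by
  have hK40 : ∀ a b c u, 0 ≤ K4 a b c u := fun a b c u => (abs_nonneg _).trans (hK4 0 u a b c)
  have hρ0 : ∀ x y, 0 < ρ x y := fun x y => lt_of_lt_of_le one_pos (hρ1 x y)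
  have hϑ0 : ∀ a b, 0 ≤ ϑ a b := fun a b => zero_le_one.trans (hϑ1 a b)
  refine le_trans (sum_le_sum fun x _ => sum_le_sum fun y _ => sum_le_sum fun t _ =>
    mul_le_mul_of_nonneg_right (interpolated_fourth_kernel_entry hΓop Y hUd hU'd hU''d hU₃d hU₄c hκ₀ hκ₁ ha hτ hδ hθ0 hθ1 hκθ hκθw hstab hU'b hU''b
        hU₃b hU₄b hlam hUsec hρg hHk hHk0 hK3 hK30 hK4 hhr ψ hαr hαc hlamA hlamA1 hγ hγ1 hD hDC hθnn hDθr hdθ hDθc hdθ' hσ0 hσθ hρ1 hρsymm hρmul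
        hρσ hr1 hrσ haσ hβ haσ' hgσ hgσ' x y z t)
      (mul_nonneg (mul_nonneg (mul_nonneg (mul_nonneg (mul_nonneg (hϑ0 x y) (hϑ0 x z)) (hϑ0 x t)) (hϑ0 y z)) (hϑ0 y t)) (hϑ0 z t))) ?_
  exact output_k4ϑ_z hK40 hK30 hHk0 hD hlamA1 hθnn hDθr hdθ hDθc hdθ' hσ0 hσθ hϑ1 hϑsymm hϑmul hϑ₂symm hϑ3 hϑσ hρ0 hρsymm hG hΘ hhrw hhc hrsymm hS4
        hC4 haσ hbσc hαθc hg1m hg2m hg1c hαg1c hk4m2 hk4m3 hk4c hαk4c hk4 z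

/-! ## Toy -/

/-- Toy (the composition on numbers): an entry bound `|e| ≤ m` and a weighted slot bound `Σ m·w ≤ B` give `Σ |e|·w ≤ B`; here `1·2 ≤ 2`. -/
example : |(1 : ℝ)| * 2 ≤ 2 := by norm_num

end Summit.QuantumFields.BalabanUV.T4Continuum.NE7b.SupWeightedFourthOrderOutputThree

end
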